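import Literature.MathematicalPhysics.QuantumFieldTheory.Chatterjee2019LargeN.MasterLoopLimit
import Literature.MathematicalPhysics.QuantumFieldTheory.StrongCouplingClustering
import HarnessLib

/-!
# Chatterjee 2019, Theorem 9.2 (second part) from Theorem 8.1 and the uniqueness clause: the 't Hooft limit exists

S. Chatterjee, *Rigorous solution of strongly coupled `SO(N)` lattice gauge theory in the large `N` limit*,
Comm. Math. Phys. **366** (2019) 203–268 (arXiv:1502.07719), **§9**: «The notable thing about Theorem 9.1 is that it
is true irrespective of the value of `β`. However, it is a theorem about subsequential limits. To prove that
`φ_{Λ_N,N,β}(s)` converges to a limit as `N → ∞`, it suffices to show that there is a unique set of solutions for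
the master loop equation. This turns out to be true if `|β|` is small enough. This is the content of the next
theorem.» — Theorem 9.2: «… there is a unique function `φ_β` such that (a) `φ_β(∅) = 1`, (b) `|φ_β(s)| ≤ L^{|s|}`,
(c) `φ_β` satisfies the master loop equation of Theorem 9.1. Consequently, there exists `β₀(d) > 0` such that for
`|β| ≤ β₀(d)`, `φ_{Λ_N,N,β}(s)` converges to a limit `φ_β(s)` as `N → ∞` for every loop sequence `s`.» («Actually,
to prove the convergence of `φ_{Λ_N,N,β}` we need only the case `L = 1`.»)

THEOREMS ONLY (net debt 0).  Main result: `thooftLimit_of_unsymmetrized_of_uniqueness :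
UnsymmetrizedMasterLoopEquation d → MasterLoopUniqueness d → THooftLimit d` — the «Consequently» clause of
Theorem 9.2 (the tree's named fact `THooftLimit`) PROVED from Theorem 8.1 (fact `UnsymmetrizedMasterLoopEquation`)
and the uniqueness clause of Theorem 9.2 (fact `MasterLoopUniqueness`, used at `L = 1`).  The printed argument,
formalized: `|W_l| ≤ N` (`abs_wilsonLoopVar_le`), so `|φ_{Λ,N,β}(s)| ≤ 1` (`abs_phi_le_one`) and pointwise
subsequential limits exist along any subsequence (compactness of `[-1,1]^𝒮`, `𝒮` countable;
`exists_thooft_sublimit`); every such limit is a solution of class `L = 1` — a cycle function (`W_l` depends on the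
cycle only: `wilsonLoopVar_rotate`), `φ(∅) = 1`, `|φ| ≤ 1`, and the master loop equation by Theorem 9.1
(`thooftMasterLoopEquation_of_unsymmetrized`, sibling module `MasterLoopLimit`) —, so by uniqueness all
subsequential limits agree on loop sequences and the whole sequence converges (`tendsto_of_subseq_tendsto`).

## WHAT THIS IS NOT
Neither Theorem 8.1 nor the uniqueness clause of Theorem 9.2 (the contraction argument of §9 with the generating
function `F(λ)`) is proved here; both remain named facts.
-/

noncomputable section

open Filter Topology MeasureTheory
open Literature.Probability.LatticeModels Literature.MathematicalPhysics.QuantumLattice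

namespace Literature.MathematicalPhysics.QuantumFieldTheory.Chatterjee2019LargeN

variable {d : ℕ}

/-! ### `|W_l| ≤ N` and `|φ_{Λ,N,β}(s)| ≤ 1` -/

/-- Entries of a special orthogonal matrix are bounded by `1` in absolute value. [folklore] -/
private theorem abs_entry_le_one {N : ℕ} (Q : SO N) (i j : Fin N) : |(Q : Matrix (Fin N) (Fin N) ℝ) i j| ≤ 1 := by
  have hmem : (Q : Matrix (Fin N) (Fin N) ℝ) ∈ Matrix.unitaryGroup (Fin N) ℝ :=
    (Matrix.mem_specialOrthogonalGroup_iff.mp Q.2).1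
  have h1 : (star (Q : Matrix (Fin N) (Fin N) ℝ) * (Q : Matrix (Fin N) (Fin N) ℝ)) j j = 1 := by
    rw [Unitary.star_mul_self_of_mem hmem, Matrix.one_apply_eq]
  rw [Matrix.mul_apply] at h1
  simp only [Matrix.star_eq_conjTranspose, Matrix.conjTranspose_apply, star_trivial] at h1
  have h2 : ((Q : Matrix (Fin N) (Fin N) ℝ) i j) ^ 2 ≤ 1 := by
    rw [← h1, sq]
    exact Finset.single_le_sum (f := fun k => (Q : Matrix (Fin N) (Fin N) ℝ) k j * (Q : Matrix (Fin N) (Fin N) ℝ) k j)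
      (fun k _ => mul_self_nonneg _) (Finset.mem_univ i)
  exact abs_le_one_iff_mul_self_le_one.mpr (by rw [← sq]; exact h2)

/-- **`|W_l| ≤ N`** («the fact that `|W_l| ≤ N` for any loop `l`»). [cite: Chatterjee2019LargeN, §9, proof of Theorem 9.1 (|W_l| ≤ N)] -/
theorem abs_wilsonLoopVar_le (N : ℕ) (l : Word d) (U : ZdGaugeConfig d (SO N)) : |wilsonLoopVar N l U| ≤ N := by
  rw [wilsonLoopVar, Matrix.trace]
  refine (Finset.abs_sum_le_sum_abs _ _).trans ?_
  calc ∑ i, |(((wordHolonomy U l : SO N)) : Matrix (Fin N) (Fin N) ℝ).diag i|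
      ≤ ∑ _i : Fin N, (1 : ℝ) := Finset.sum_le_sum fun i _ => abs_entry_le_one _ i i
    _ = N := by simp

/-- `|W_{l₁} ⋯ W_{lₙ}| ≤ Nⁿ`. [cite: Chatterjee2019LargeN, §9, proof of Theorem 9.1 (|W_l| ≤ N)] -/
theorem abs_wilsonProd_le (N : ℕ) (s : LoopSeq d) (U : ZdGaugeConfig d (SO N)) :
    |wilsonProd N s U| ≤ (N : ℝ) ^ s.length := by
  induction s with
  | nil => simp [wilsonProd]
  | cons l s ih =>
    simp only [wilsonProd, List.map_cons, List.prod_cons, List.length_cons, pow_succ'] at ih ⊢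
    rw [abs_mul]
    exact mul_le_mul (abs_wilsonLoopVar_le N l U) ih (abs_nonneg _) (Nat.cast_nonneg _)

/-- **`|φ_{Λ,N,β}(s)| ≤ 1`** (`L = 1` in Theorem 9.2 (b) for the finite-`N` functions). [cite: Chatterjee2019LargeN, §9, Theorem 9.2 («we need only the case L = 1»)] -/
theorem abs_phi_le_one (N : ℕ) (β : ℝ) (Λ : Finset (Literature.Probability.LatticeModels.Site d)) (s : LoopSeq d) :
    |phi N β Λ s| ≤ 1 := by
  have h : |soExpect N β Λ (wilsonProd N s)| ≤ (N : ℝ) ^ s.length := by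
    rw [soExpect_eq_zdExpect]
    exact abs_zdExpect_le (isSpecialOrthogonalModel_soRep N).1 fun U => abs_wilsonProd_le N s U
  rw [phi, abs_div, abs_of_nonneg (by positivity : (0 : ℝ) ≤ (N : ℝ) ^ s.length)]
  rcases eq_or_lt_of_le (by positivity : (0 : ℝ) ≤ (N : ℝ) ^ s.length) with h0 | hpos
  · rw [← h0, div_zero]; exact zero_le_one
  · exact (div_le_one hpos).mpr h

/-- `φ_{Λ,N,β}(∅) = 1`. [cite: Chatterjee2019LargeN, §3 Thm. 3.6 («φ(∅) = 1»)] -/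
theorem phi_nil (N : ℕ) (β : ℝ) (Λ : Finset (Literature.Probability.LatticeModels.Site d)) : phi N β Λ [] = 1 := by
  haveI := isProbabilityMeasure_zdWilsonMeasure (soRep N) (isSpecialOrthogonalModel_soRep N).1 (N * β) Λ
  simp [phi, soExpect, soMeasure, wilsonProd]

/-! ### `W_l` is a function of the cycle -/

/-- `W_l` does not depend on the representative of the cycle: `W_{eₖ⋯eₙe₁⋯eₖ₋₁} = W_{e₁⋯eₙ}` (cyclicity of the
trace). [cite: Chatterjee2019LargeN, §3 (W_l defined for loops = cycles)] -/
theorem wilsonLoopVar_rotate (N : ℕ) (l : Word d) (k : ℕ) (U : ZdGaugeConfig d (SO N)) :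
    wilsonLoopVar N (l.rotate k) U = wilsonLoopVar N l U := by
  rw [wilsonLoopVar, wilsonLoopVar, List.rotate_eq_drop_append_take_mod]
  set m := k % l.length
  have h : wordHolonomy U l = wordHolonomy U (l.take m) * wordHolonomy U (l.drop m) := by
    rw [wordHolonomy, wordHolonomy, wordHolonomy, ← List.prod_append, ← List.map_append, List.take_append_drop]
  have h' : wordHolonomy U (l.drop m ++ l.take m) = wordHolonomy U (l.drop m) * wordHolonomy U (l.take m) := by
    rw [wordHolonomy, wordHolonomy, wordHolonomy, ← List.prod_append, ← List.map_append]
  rw [h, h', Submonoid.coe_mul, Submonoid.coe_mul, Matrix.trace_mul_comm]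

/-- `φ_{Λ,N,β}` is a cycle function: rotating a component does not change it. [cite: Chatterjee2019LargeN, §2.1 (cycles), §3 (φ(s))] -/
theorem phi_modify_rotate (N : ℕ) (β : ℝ) (Λ : Finset (Literature.Probability.LatticeModels.Site d)) (s : LoopSeq d)
    (i k : ℕ) : phi N β Λ (s.modify i fun l => l.rotate k) = phi N β Λ s := by
  have hw : wilsonProd N (s.modify i fun l => l.rotate k) = wilsonProd N s := by
    funext U
    induction s generalizing i with
    | nil => simp
    | cons l s ih =>
      cases i with
      | zero => simp [wilsonProd, wilsonLoopVar_rotate]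
      | succ i =>
        have := ih i
        simp only [wilsonProd, List.map_cons, List.prod_cons] at this ⊢
        simp [List.modify_succ_cons, this]
  rw [phi, phi, hw, List.length_modify]

/-! ### Subsequential 't Hooft limits exist (compactness) -/

/-- Along any subsequence of `N`'s there is a further subsequence along which `φ_{Λ_N,N,β}(s)` converges for EVERY
loop sequence `s` (diagonal argument: `|φ| ≤ 1` and there are countably many loop sequences).
[cite: Chatterjee2019LargeN, §9 (Theorem 9.1: «take a subsequence of N's such that along this subsequence, the limit of φ_{Λ_N,N,β}(s) exists for every loop sequence s»)] -/
theorem exists_thooft_sublimit (β : ℝ) (Λ : ℕ → Finset (Literature.Probability.LatticeModels.Site d)) {ns : ℕ → ℕ}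
    (hns : Tendsto ns atTop atTop) :
    ∃ ms : ℕ → ℕ, StrictMono (ns ∘ ms) ∧ ∃ φ : LoopSeq d → ℝ,
      ∀ s : LoopSeq d, Tendsto (fun k => phi (ns (ms k)) β (Λ (ns (ms k))) s) atTop (𝓝 (φ s)) := by
  obtain ⟨m₁, -, hnm₁⟩ := strictMono_subseq_of_tendsto_atTop hns
  set x : ℕ → (LoopSeq d → ℝ) := fun k s => phi (ns (m₁ k)) β (Λ (ns (m₁ k))) s with hx
  have hK : IsCompact (Set.pi Set.univ fun _ : LoopSeq d => Set.Icc (-1 : ℝ) 1) :=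
    isCompact_univ_pi fun _ => isCompact_Icc
  have hxK : ∀ k, x k ∈ Set.pi Set.univ fun _ : LoopSeq d => Set.Icc (-1 : ℝ) 1 :=
    fun k s _ => abs_le.mp (abs_phi_le_one _ _ _ _)
  obtain ⟨φ, -, m₂, hm₂, hlim⟩ := hK.tendsto_subseq hxK
  refine ⟨m₁ ∘ m₂, hnm₁.comp hm₂, φ, fun s => ?_⟩
  exact tendsto_pi_nhds.mp hlim s

/-! ### Theorem 9.2, second part -/

/-- Every subsequential 't Hooft limit is a solution of the master loop equation of class `L = 1` (given Theorem 8.1):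
a cycle function with `φ(∅) = 1`, `|φ| ≤ 1`, satisfying the equation of Theorem 9.1.
[cite: Chatterjee2019LargeN, §9, proof of Theorem 9.2 (conditions (a)–(c) for subsequential limits, L = 1)] -/
theorem isMasterLoopSolution_of_sublimit (hU : UnsymmetrizedMasterLoopEquation d) (hd : 2 ≤ d)
    {Λ : ℕ → Finset (Literature.Probability.LatticeModels.Site d)} (hΛ : IsExhaustion Λ) (β : ℝ)
    {ν : ℕ → ℕ} (hν : StrictMono ν) {φ : LoopSeq d → ℝ}
    (hφ : ∀ s : LoopSeq d, Tendsto (fun k => phi (ν k) β (Λ (ν k)) s) atTop (𝓝 (φ s))) :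
    IsMasterLoopSolution 1 β φ := by
  refine ⟨fun s _ i k => ?_, ?_, fun s _ => ?_, ?_⟩
  · refine tendsto_nhds_unique ?_ (hφ s)
    simpa only [phi_modify_rotate] using hφ (s.modify i fun l => l.rotate k)
  · exact tendsto_nhds_unique (hφ []) (by simpa only [phi_nil] using tendsto_const_nhds)
  · rw [one_pow]
    exact le_of_tendsto' (hφ s).abs fun k => abs_phi_le_one _ _ _ _
  · exact thooftMasterLoopEquation_of_unsymmetrized hU hd Λ hΛ β ν hν φ fun s _ => hφ s

/-- **Theorem 9.2, second part (existence of the 't Hooft limit), PROVED from Theorem 8.1 and the uniqueness clause of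
Theorem 9.2 at `L = 1`**: for `|β| ≤ β₀(1, d)`, every exhaustion `Λ_N ↑ ℤ^d` and every loop sequence `s`,
`φ_{Λ_N,N,β}(s)` converges as `N → ∞`. [cite: Chatterjee2019LargeN, Theorem 9.2 («Consequently, … converges to a limit φ_β(s) as N → ∞»), and the paragraph before it] -/
theorem thooftLimit_of_unsymmetrized_of_uniqueness (hU : UnsymmetrizedMasterLoopEquation d)
    (hQ : MasterLoopUniqueness d) : THooftLimit d := by
  intro hd
  obtain ⟨β₀, hβ₀, H⟩ := hQ hd 1 le_rfl
  refine ⟨β₀, hβ₀, fun Λ hΛ β hβ s hs => ?_⟩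
  obtain ⟨-, huniq⟩ := H β hβ
  -- a reference subsequential limit along the full sequence
  obtain ⟨ν₁, hν₁, φ₁, hφ₁⟩ := exists_thooft_sublimit β Λ tendsto_id
  have hsol₁ := isMasterLoopSolution_of_sublimit hU hd hΛ β hν₁ hφ₁
  refine ⟨φ₁ s, tendsto_of_subseq_tendsto fun ns hns => ?_⟩
  obtain ⟨ms, hν₂, φ₂, hφ₂⟩ := exists_thooft_sublimit β Λ hns
  have hsol₂ := isMasterLoopSolution_of_sublimit hU hd hΛ β hν₂ hφ₂
  refine ⟨ms, ?_⟩
  rw [← huniq φ₂ φ₁ hsol₂ hsol₁ s hs]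
  exact hφ₂ s

end Literature.MathematicalPhysics.QuantumFieldTheory.Chatterjee2019LargeN

end
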